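import Mathlib.AlgebraicGeometry.Morphisms.Flat
import Mathlib.RingTheory.Flat.TorsionFree
import Mathlib.Algebra.Category.ModuleCat.Sheaf
import Mathlib.Algebra.Category.Grp.EpiMono
import Mathlib.AlgebraicGeometry.Modules.Presheaf
import Mathlib.CategoryTheory.Adjunction.Evaluation
import Mathlib.RingTheory.WittVector.Domain
import Mathlib.RingTheory.WittVector.Identities
import HarnessLib

/-!
# Sections of a flat `R`-scheme have no torsion by regular elements of `R`

Let `f : X ⟶ Spec R` be a FLAT morphism of schemes (Mathlib `AlgebraicGeometry.Flat`: affine-locally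
`RingHom.Flat`) and let `t ∈ R ≅ Γ(Spec R, ⊤)` be a regular element (a non-zero-divisor). Then
multiplication by (the image of) `t` is injective on `Γ(X, U)` for EVERY open `U ⊆ X`:

* `eq_zero_of_appLE_mul_eq_zero_of_isAffineOpen` — the affine case: `Γ(X, V)` is a flat
  `Γ(Spec R, ⊤)`-algebra, and a regular element stays regular on a flat module
  (`Module.Flat.isSMulRegular_of_isRegular`);
* `eq_zero_of_appLE_mul_eq_zero` — any open `U`: a section killed by `t` vanishes on every affine
  open inside `U`, hence has zero germs, hence is zero (sheaf locality, `TopCat.Presheaf.section_ext`);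
* `eq_zero_of_intCast_mul_eq_zero`, `eq_zero_of_zsmul_eq_zero` — the case of an INTEGER `n` whose
  image in `R` is regular (`isRegular_ΓSpec_intCast` transports regularity along
  `Scheme.ΓSpecIso R`);
* `mono_zsmul_id_of_forall` — on any site, an abelian sheaf `F` whose groups of sections have
  no `q`-torsion has `q • 𝟙 F` mono (`Sheaf.Hom.mono_of_presheaf_mono` + `NatTrans.mono_of_mono_app`;
  `zsmul_id_hom_app`: `(q • 𝟙 F)` acts on sections as multiplication by `q`);
* `mono_zsmul_id_structureSheaf` — hence for `X ⟶ Spec R` flat and `(n : R)` regular, multiplication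
  by `n` is a MONOMORPHISM of the abelian sheaf underlying `𝒪_X`, i.e. of
  `(SheafOfModules.toSheaf X.ringCatSheaf).obj (SheafOfModules.unit X.ringCatSheaf)` — the sheaf
  whose `Sheaf.H` is the tree's `Motives.structureSheafCohomology X` — so that the Bockstein /
  "cohomology and base change mod `nᵐ`" package `Algebra/Homology/ExtCokernelBockstein`
  (`Sheaf.H.map_cokernel_π_pow_surjective`, …) applies to `𝒪_X` with `q = n`;
* `WittVector.isRegular_natCast_p`, `mono_p_smul_id_structureSheaf_of_flat_witt` — the case the
  `p`-adic deformation theory of vector bundles needs: `𝒳` flat (e.g. smooth) over `W(k)`, `k` a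
  field of characteristic `p`; `p ≠ 0` in the domain `W(k)` (Mathlib `WittVector.p_nonzero`,
  `WittVector.instIsDomain`), so `p • 𝟙 𝒪_𝒳` is mono and `Γ(𝒳, U)` has no `p`-torsion
  (Bloch–Esnault–Kerz 2014, §8; Berthelot–Ogus 1983, proof of Thm. 3.8: `𝒪_{X_n} = 𝒪_𝒳 / pⁿ`).

Sources: EGA IV₂ (Publ. IHÉS 24, 1965) Prop. 2.1.13 / Cor. 3.4.7 (flatness and regular elements);
The Stacks project, Tag 00HI (flat modules and injective maps) and Tag 01U2 (flat morphisms).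
Everything here is proved from Mathlib; there are no named facts. NOT here: the same for a flat
quasi-coherent / locally free `𝒪_X`-module in place of `𝒪_X` (same proof through local frames),
and the identification of `𝒪_X / nᵐ` with the structure sheaf of the closed subscheme `X ⊗ R/nᵐ`.
-/

noncomputable section

namespace Literature.AlgebraicGeometry.Modules

open CategoryTheory CategoryTheory.Limits _root_.AlgebraicGeometry Opposite TopologicalSpace

universe w v' u' u

/-! ## 1. Regular elements of `R` act injectively on the sections of a flat `R`-scheme -/

section Flat

variable {R : CommRingCat.{u}} {X : Scheme.{u}} (f : X ⟶ Spec R) [Flat f]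

include f

/-- **Affine case.** For `f : X ⟶ Spec R` flat, `V ⊆ X` an affine open and `t ∈ Γ(Spec R, ⊤)`
regular, a section `s ∈ Γ(X, V)` with `t · s = 0` is zero: `Γ(X, V)` is a flat
`Γ(Spec R, ⊤)`-algebra (definition of `Flat f`) and regular elements stay regular on flat modules
(Stacks 00HI; EGA IV₂ 2.1.13). [cite: StacksProject, Tag 00HI] -/
theorem eq_zero_of_appLE_mul_eq_zero_of_isAffineOpen {V : X.Opens} (hV : IsAffineOpen V)
    {t : Γ(Spec R, ⊤)} (ht : IsRegular t) (e : V ≤ f ⁻¹ᵁ ⊤) (s : Γ(X, V))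
    (hs : f.appLE ⊤ V e t * s = 0) : s = 0 := by
  have hflat : (f.appLE ⊤ V e).hom.Flat := f.flat_appLE (isAffineOpen_top (Spec R)) hV e
  letI := (f.appLE ⊤ V e).hom.toAlgebra
  haveI : Module.Flat Γ(Spec R, ⊤) Γ(X, V) := hflat
  have hreg : IsSMulRegular Γ(X, V) t := Module.Flat.isSMulRegular_of_isRegular ht
  have h1 : t • s = t • (0 : Γ(X, V)) := by
    rw [smul_zero, Algebra.smul_def]
    exact hs
  exact hreg h1

omit [Flat f] in
/-- The image of `t ∈ Γ(Spec R, ⊤)` in `Γ(X, U)` restricts to its image in `Γ(X, V)` for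
`V ⊆ U`. [folklore] -/
theorem map_appLE_top {U V : X.Opens} (hVU : V ≤ U) (e : U ≤ f ⁻¹ᵁ ⊤) (t : Γ(Spec R, ⊤)) :
    X.presheaf.map (homOfLE hVU).op (f.appLE ⊤ U e t) = f.appLE ⊤ V (hVU.trans e) t := by
  rw [← CommRingCat.comp_apply, Scheme.Hom.appLE_map]

/-- **Any open.** For `f : X ⟶ Spec R` flat, `U ⊆ X` open and `t ∈ Γ(Spec R, ⊤)` regular, a
section `s ∈ Γ(X, U)` with `t · s = 0` is zero: it vanishes on every affine open `V ⊆ U`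
(`eq_zero_of_appLE_mul_eq_zero_of_isAffineOpen`), the affine opens form a basis, so all its
germs vanish, so `s = 0` by the sheaf property (Stacks 01U2 with 00HI). [cite: StacksProject, Tag 00HI] -/
theorem eq_zero_of_appLE_mul_eq_zero (U : X.Opens) {t : Γ(Spec R, ⊤)} (ht : IsRegular t)
    (e : U ≤ f ⁻¹ᵁ ⊤) (s : Γ(X, U)) (hs : f.appLE ⊤ U e t * s = 0) : s = 0 := by
  apply TopCat.Presheaf.section_ext X.sheaf U s 0
  intro x hx
  obtain ⟨_, ⟨V, hV, rfl⟩, hxV, hVU⟩ := X.isBasis_affineOpens.exists_subset_of_mem_open hx U.2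
  have hVU' : V ≤ U := hVU
  have key : X.presheaf.map (homOfLE hVU').op s = 0 := by
    refine eq_zero_of_appLE_mul_eq_zero_of_isAffineOpen f hV ht (hVU'.trans e) _ ?_
    have h2 := congrArg (X.presheaf.map (homOfLE hVU').op) hs
    rw [map_mul, map_zero, map_appLE_top f hVU' e t] at h2
    exact h2
  change X.presheaf.germ U x hx s = X.presheaf.germ U x hx 0
  rw [← TopCat.Presheaf.germ_res_apply X.presheaf (homOfLE hVU') x hxV s, key, map_zero, map_zero]

omit f [Flat f] in
/-- Regularity is reflected by the isomorphism `Γ(Spec R, ⊤) ≅ R` (`Scheme.ΓSpecIso`): if the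
image of `t` in `R` is regular then `t` is regular. [folklore] -/
theorem isRegular_of_isRegular_ΓSpecIso (t : Γ(Spec R, ⊤))
    (ht : IsRegular ((Scheme.ΓSpecIso R).hom t)) : IsRegular t := by
  have hinj : Function.Injective (Scheme.ΓSpecIso R).hom :=
    (Scheme.ΓSpecIso R).commRingCatIsoToRingEquiv.injective
  refine ⟨fun a b h => hinj (ht.left ?_), fun a b h => hinj (ht.right ?_)⟩
  · have h' := congrArg (Scheme.ΓSpecIso R).hom h
    simp only [map_mul] at h'
    exact h'
  · have h' := congrArg (Scheme.ΓSpecIso R).hom h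
    simp only [map_mul] at h'
    exact h'

omit f [Flat f] in
/-- If the integer `n` is regular in `R` then it is regular in `Γ(Spec R, ⊤)`. [folklore] -/
theorem isRegular_ΓSpec_intCast (n : ℤ) (hn : IsRegular (n : R)) :
    IsRegular (n : Γ(Spec R, ⊤)) :=
  isRegular_of_isRegular_ΓSpecIso (n : Γ(Spec R, ⊤)) (by rwa [map_intCast])

/-- **Integer version.** For `f : X ⟶ Spec R` flat and an integer `n` whose image in `R` is
regular (e.g. `R` a domain of characteristic `0` or prime to `n`), `n · s = 0` in `Γ(X, U)` forces
`s = 0`, for every open `U`. [cite: StacksProject, Tag 00HI] -/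
theorem eq_zero_of_intCast_mul_eq_zero (n : ℤ) (hn : IsRegular (n : R)) (U : X.Opens)
    (s : Γ(X, U)) (hs : (n : Γ(X, U)) * s = 0) : s = 0 := by
  have e : U ≤ f ⁻¹ᵁ ⊤ := le_top
  refine eq_zero_of_appLE_mul_eq_zero f U (isRegular_ΓSpec_intCast n hn) e s ?_
  rwa [map_intCast]

/-- **Integer version, `•` form.** For `f : X ⟶ Spec R` flat and an integer `n` regular in `R`,
the abelian group `Γ(X, U)` has no `n`-torsion: `n • s = 0 → s = 0`. [cite: StacksProject, Tag 00HI] -/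
theorem eq_zero_of_zsmul_eq_zero (n : ℤ) (hn : IsRegular (n : R)) (U : X.Opens)
    (s : Γ(X, U)) (hs : n • s = 0) : s = 0 :=
  eq_zero_of_intCast_mul_eq_zero f n hn U s (by rwa [← zsmul_eq_mul])

end Flat

/-! ## 2. Abelian sheaves without `q`-torsion: `q • 𝟙 F` is a monomorphism -/

section MonoSMul

variable {C : Type u'} [Category.{v'} C] {J : GrothendieckTopology C}
  (F : Sheaf J AddCommGrpCat.{w}) (q : ℤ)

/-- `q • 𝟙 F` acts on the sections of the abelian sheaf `F` as multiplication by `q`.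
[folklore] -/
theorem zsmul_id_hom_app (U : Cᵒᵖ) (s : F.obj.obj U) : (q • 𝟙 F).hom.app U s = q • s := by
  let Φ : (F ⟶ F) →+ (F.obj.obj U ⟶ F.obj.obj U) :=
    AddMonoidHom.mk' (fun g : F ⟶ F => (g.hom.app U : F.obj.obj U ⟶ F.obj.obj U))
      (fun g g' => Sheaf.Hom.add_app g g' U)
  have h1 : (q • 𝟙 F).hom.app U = q • (𝟙 (F.obj.obj U) : F.obj.obj U ⟶ F.obj.obj U) := by
    change Φ (q • 𝟙 F) = _
    rw [map_zsmul]
    rfl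
  rw [h1]
  rfl

/-- **No `q`-torsion on sections ⇒ `q • 𝟙 F` mono.** If every group of sections `F(U)` of an
abelian sheaf `F` (on any site) has no `q`-torsion, then multiplication by `q` is a
monomorphism `F ⟶ F` of sheaves (componentwise injective ⇒ mono as presheaves ⇒ mono as
sheaves). [folklore] -/
theorem mono_zsmul_id_of_forall
    (h : ∀ (U : Cᵒᵖ) (s : F.obj.obj U), q • s = 0 → s = 0) : Mono (q • 𝟙 F) := by
  haveI : ∀ U, Mono ((q • 𝟙 F).hom.app U) := fun U => by
    rw [AddCommGrpCat.mono_iff_injective]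
    intro a b hab
    rw [zsmul_id_hom_app, zsmul_id_hom_app] at hab
    have hq : q • (a - b) = 0 := by rw [smul_sub, hab, sub_self]
    exact sub_eq_zero.1 (h U _ hq)
  haveI : Mono (q • 𝟙 F).hom := NatTrans.mono_of_mono_app _
  exact Sheaf.Hom.mono_of_presheaf_mono J _ (q • 𝟙 F)

end MonoSMul

/-! ## 3. The structure sheaf of a flat `R`-scheme -/

section StructureSheaf

variable {R : CommRingCat.{u}} {X : Scheme.{u}} (f : X ⟶ Spec R) [Flat f]

include f

/-- **`n • 𝟙 𝒪_X` is mono.** For `f : X ⟶ Spec R` flat and an integer `n` regular in `R`,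
multiplication by `n` is a monomorphism of the abelian sheaf underlying the structure sheaf
`𝒪_X` (the sheaf `(SheafOfModules.toSheaf X.ringCatSheaf).obj (SheafOfModules.unit _)`, whose
cohomology `Sheaf.H` is `Motives.structureSheafCohomology X`). [cite: StacksProject, Tag 00HI] -/
theorem mono_zsmul_id_structureSheaf (n : ℤ) (hn : IsRegular (n : R)) :
    Mono (n • 𝟙 ((SheafOfModules.toSheaf X.ringCatSheaf).obj
      (SheafOfModules.unit X.ringCatSheaf))) := by
  apply mono_zsmul_id_of_forall
  intro U s hs
  exact eq_zero_of_zsmul_eq_zero f n hn U.unop s hs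

end StructureSheaf

/-! ## 4. Schemes flat over the Witt vectors `W(k)` -/

section Witt

variable (p : ℕ) [Fact p.Prime] (k : Type u) [CommRing k] [IsDomain k] [CharP k p]

/-- `p` is a regular element (non-zero-divisor) of the domain `W(k)` for `k` a domain of
characteristic `p` (Mathlib: `WittVector.p_nonzero`, `WittVector.instIsDomain`). [folklore] -/
theorem WittVector.isRegular_natCast_p : IsRegular ((p : ℕ) : WittVector p k) :=
  IsRegular.of_ne_zero (WittVector.p_nonzero p k)

/-- The same for the integer `p`. [folklore] -/
theorem WittVector.isRegular_intCast_p : IsRegular ((p : ℤ) : WittVector p k) := by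
  rw [Int.cast_natCast]
  exact WittVector.isRegular_natCast_p p k

variable {p k}
variable {𝒳 : Scheme.{u}} (f : 𝒳 ⟶ Spec (CommRingCat.of (WittVector p k))) [Flat f]

include f

/-- **Sections of a flat `W(k)`-scheme have no `p`-torsion**: for `𝒳 ⟶ Spec W(k)` flat (e.g.
smooth) and any open `U`, `p • s = 0` in `Γ(𝒳, U)` forces `s = 0` (Berthelot–Ogus 1983, proof of
Thm. 3.8; Bloch–Esnault–Kerz 2014, §8). [cite: StacksProject, Tag 00HI] -/
theorem eq_zero_of_p_smul_eq_zero_of_flat_witt (U : 𝒳.Opens) (s : Γ(𝒳, U))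
    (hs : (p : ℤ) • s = 0) : s = 0 :=
  eq_zero_of_zsmul_eq_zero f (p : ℤ) (WittVector.isRegular_intCast_p p k) U s hs

/-- **`p • 𝟙 𝒪_𝒳` is mono** for `𝒳` flat (e.g. smooth) over `W(k)`: the hypothesis under which
`H^b(𝒳, 𝒪_𝒳) ↠ H^b(𝒳, 𝒪_𝒳 / pᵐ)` for `p`-torsion-free `H^{b+1}(𝒳, 𝒪_𝒳)`
(`Algebra/Homology/ExtCokernelBockstein`, `Sheaf.H.map_cokernel_π_pow_surjective` with `q = p`).
[cite: StacksProject, Tag 00HI] -/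
theorem mono_p_smul_id_structureSheaf_of_flat_witt :
    Mono ((p : ℤ) • 𝟙 ((SheafOfModules.toSheaf 𝒳.ringCatSheaf).obj
      (SheafOfModules.unit 𝒳.ringCatSheaf))) :=
  mono_zsmul_id_structureSheaf f (p : ℤ) (WittVector.isRegular_intCast_p p k)

end Witt

end Literature.AlgebraicGeometry.Modules
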